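import Literature.IUT.HodgeTheaters.PuncturedEllipticArrowModelIotaLaw
import Literature.IUT.HodgeTheaters.PuncturedEllipticArrowModelLiftModLCuspLaws
import HarnessLib

/-!
# [IUTchI] §1 — the `ι`-law `hι'` of Cor. 1.2 and the bridge inputs `hIH`, `hXH` HOLD at the Γ-LIFTED §1
# model `pedOf Γ l` (inside `Γ × (N ⋊ D_l)`, every profinite `Γ = G_k`) and at the `ThetaGeometry`
# `geometryOf G_K l` (NV witness, proof-only)

Mochizuki, *Inter-universal Teichmüller theory I*, kurims manuscript (May 2020), §1 pp. 37–39, Def. 3.1 (d)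
p. 62 ([IUTchI] §1 p.38) [claim: Mochizuki2012, status: disputed] — WITNESS-class module (pure group theory
over abc-iut-L5-t1's lifted model `ArrowModel.pedOf Γ l h5 h6` / `ArrowModel.geometryOf G_K l`, p430830 /
p431229); nothing of the series is asserted; no side is taken on [IUTchIII] Cor. 3.12.  Node `IUTchI:Cor1.2`
(abc-iut-L5-d4 gen 9); proof-only companion of `PuncturedEllipticArrowModelIotaLaw.lean` (p449693: the three
laws at the `G_k = 1` datum `ArrowModel.datum`) and `PuncturedEllipticArrowModelLiftModLCuspLaws.lean`
(p450225: `ModLCuspLaws` at the lift); no definitions, nothing restated.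

WHAT.  The Cor. 1.2 closer of record `InitialThetaData.pe_characteristicNatureOfCoverings_viaX_of_laws`
(p448270) binds at the primed `K`-level datum the `ι`-law `hι'` ("an element of `Δ_C̲ ∖ Δ_X̲` does not
centralise `Δ_X` modulo `H = Ker(Δ_X ↠ Δ_X^{ab} ⊗ ℤ/lℤ)`", print p. 38 l. 1 "`ι` acts on `Δ_E ⊗ (ℤ/lℤ)` via
multiplication by `−1`") through abc-iut-L5-t1's `ModLCuspLaws` (`ModLCuspLaws.exists_commutator_not_mem_H`)
from the two classical inputs `hIH` ("every cusp inertia group lies in `H`") and `hXH` ("`Δ_X̲ ⊄ H`").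
p449693 witnessed all three at the finite model with TRIVIAL Galois group.  Here they are TRANSPORTED along
`{1} × (·)` (`botSub`) to the datum over an ARBITRARY profinite `Γ` — the datum `(geometryOf G_K l …).pe =
pedOf G_K l …` at which abc-iut-L5-t1's {`CuspGalois` (`liftCuspGalois`), `ArrowCoveringClaims`, `Rmk121`,
`ArrowOpenClaims`, `ModLCuspLaws` (`pedOf_modLCuspLaws`, p450225)} already fire jointly, i.e. a
`ThetaGeometry`-level datum of the kind the Layer-5 certificate's (C6)/(K′) conjuncts quantify over:
* `ArrowModel.H_eq_of_deltaX_eq` — `H` depends on `Δ_X` only (rewriting helper, any `PuncturedEllipticData`);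
* `ArrowModel.pedOf_H_eq` — at `pedOf Γ l`, `H = {1} × H₀` with `H₀ = ⁅Φ_X, Φ_X⁆ · Φ_X^l ⊆ Φ_X = N ⋊ ⟨r⟩`
  (`Δ_X = {1} × Φ_X`; `{1} × H₀` is closed: `= (Γ × H₀) ∩ Δ_C`); `ArrowModel.datum_H_eq` — `H(datum) = H₀`;
* `ArrowModel.pedOf_inertia_le_H` (hIH), `ArrowModel.pedOf_not_deltaXbar_le_H` (hXH),
  `ArrowModel.pedOf_iotaLaw` (hι') — from p449693's `inertia_le_H_datum`, `not_deltaXbar_le_H_datum`,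
  `iotaLaw_datum` BY NAME;
* `ArrowModel.geometryOf_pe_iotaLaws` — the same three at `(geometryOf G_K l hGK h5 h6).pe`;
* `ArrowModel.exists_thetaGeometry_iotaLaws` / `…_galois_iotaLaws` — packaged ∃-forms: over every compact
  totally disconnected `G_F ⊇ G_K` (closed), resp. over a genuine Galois tower `F ⊆ K ⊆ F̄`, ONE `ThetaGeometry`
  carries `ArrowCoveringClaims ∧ Rmk121 ∧ Nonempty CuspGalois ∧ ModLCuspLaws ∧ hι' ∧ hIH ∧ hXH` — every input
  AND the output of the `ι`-law chain of [IUTchI] Cor. 1.2, together with the cusp action, at a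
  `ThetaGeometry`-level datum.
Label: [model; semi-synthetic — genuine `Γ`, finite geometric part `N ⋊ D_l`]; inhabited ≠ discharged at the
genuine datum; the rank form `hrank` (`[Δ_X : H] = l²`) is NOT witnessed here (`[Φ_X : H₀] = l³` at this
model) — only its consequence `hXH`.
-/

namespace Literature.IUT.HodgeTheaters

namespace PuncturedEllipticData

namespace ArrowModel

open Literature.AnabelianGeometry.AbsoluteAnabelian DihedralGroup
open scoped Pointwise

universe u

/-! ### `H = Ker(Δ_X ↠ Δ_X^{ab} ⊗ ℤ/lℤ)` depends on `Δ_X` only -/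

/-- Rewriting helper: `H = Ker(Δ_X ↠ Δ_X^{ab} ⊗ ℤ/lℤ)` (the closed subgroup of the frozen hypothesis (∗)) along
an identification `Δ_X = S` (both the subgroup-level and the set-level occurrence of `Δ_X = Π_X ∩ Δ_C`).
([IUTchI] §1 p.37) [claim: Mochizuki2012, status: disputed] -/
theorem H_eq_of_deltaX_eq (D : PuncturedEllipticData.{u}) {S : Subgroup D.PiC} (hS : D.PiX ⊓ D.DeltaC = S) :
    (⁅D.PiX ⊓ D.DeltaC, D.PiX ⊓ D.DeltaC⁆ ⊔
        Subgroup.closure ((fun y : D.PiC => y ^ D.l) '' (D.PiX ⊓ D.DeltaC : Set D.PiC))).topologicalClosure =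
      (⁅S, S⁆ ⊔ Subgroup.closure ((fun y : D.PiC => y ^ D.l) '' (S : Set D.PiC))).topologicalClosure := by
  subst hS
  rfl

/-! ### Transport of commutators and `l`-th powers along `{1} × (·)` -/

section LiftGroup

variable (Γ : Type) [Group Γ] (l : ℕ)

/-- `⁅{1} × A, {1} × B⁆ = {1} × ⁅A, B⁆`. [claim: Mochizuki2012, status: disputed] -/
theorem botSub_commutator (A B : Subgroup (G l)) :
    ⁅botSub Γ l A, botSub Γ l B⁆ = botSub Γ l ⁅A, B⁆ :=
  (Subgroup.map_commutator A B (MonoidHom.inr Γ (G l))).symm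

/-- `⟨l-th powers of {1} × A⟩ = {1} × ⟨l-th powers of A⟩`. [claim: Mochizuki2012, status: disputed] -/
theorem closure_pow_botSub (A : Subgroup (G l)) :
    Subgroup.closure ((fun y : Γ × G l => y ^ l) '' (botSub Γ l A : Set (Γ × G l))) =
      botSub Γ l (Subgroup.closure ((fun y : G l => y ^ l) '' (A : Set (G l)))) := by
  rw [botSub_closure, botSub, Subgroup.coe_map, Set.image_image, Set.image_image]
  congr 1
  refine Set.image_congr fun y _ => ?_
  exact (map_pow (MonoidHom.inr Γ (G l)) y l).symm

/-- `⁅{1} × A, {1} × A⁆ · ({1} × A)^l = {1} × (⁅A, A⁆ · A^l)`. [claim: Mochizuki2012, status: disputed] -/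
theorem botSub_frattini (A : Subgroup (G l)) :
    ⁅botSub Γ l A, botSub Γ l A⁆ ⊔
        Subgroup.closure ((fun y : Γ × G l => y ^ l) '' (botSub Γ l A : Set (Γ × G l))) =
      botSub Γ l (⁅A, A⁆ ⊔ Subgroup.closure ((fun y : G l => y ^ l) '' (A : Set (G l)))) := by
  rw [botSub_commutator, closure_pow_botSub, botSub_sup]

/-- `botSub` reflects the order: `{1} × A ≤ {1} × B → A ≤ B`. [claim: Mochizuki2012, status: disputed] -/
theorem le_of_botSub_le {A B : Subgroup (G l)} (h : botSub Γ l A ≤ botSub Γ l B) : A ≤ B := fun a ha =>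
  (mem_botSub (x := ((1 : Γ), a)).mp (h (mem_botSub.mpr ⟨rfl, ha⟩))).2

/-- For `c = (1, c₂)` and `v = (1, v₂)`: `c v c⁻¹ v⁻¹ ∈ {1} × B ↔ c₂ v₂ c₂⁻¹ v₂⁻¹ ∈ B`.
[claim: Mochizuki2012, status: disputed] -/
theorem lift_comm_mem_botSub_iff {c : Γ × G l} (hc1 : c.1 = 1) (v : G l) (B : Subgroup (G l)) :
    c * ((1 : Γ), v) * c⁻¹ * ((1 : Γ), v)⁻¹ ∈ botSub Γ l B ↔ c.2 * v * c.2⁻¹ * v⁻¹ ∈ B := by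
  rw [mem_botSub]
  simp only [Prod.fst_mul, Prod.fst_inv, Prod.snd_mul, Prod.snd_inv, hc1, mul_one, inv_one, true_and]

end LiftGroup

/-! ### `H` at the `G_k = 1` datum -/

section Datum

variable {l : ℕ} (h5 : 5 ≤ l) (h6 : Nat.Coprime l 6)

/-- At the `G_k = 1` datum, `Δ_X = Φ_X = N ⋊ ⟨r⟩`. [claim: Mochizuki2012, status: disputed] -/
theorem datum_deltaX : (datum l h5 h6).PiX ⊓ (datum l h5 h6).DeltaC = PiXm l := by
  rw [deltaC_eq_top, inf_top_eq]

/-- At the `G_k = 1` datum (discrete topology), `H = H₀ := ⁅Φ_X, Φ_X⁆ · Φ_X^l` (the subgroup `H₀` of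
`Φ = N ⋊ D_l` regarded as a subgroup of `Π_C = Φ`). ([IUTchI] §1 p.37) [claim: Mochizuki2012, status: disputed] -/
theorem datum_H_eq :
    (⁅(datum l h5 h6).PiX ⊓ (datum l h5 h6).DeltaC, (datum l h5 h6).PiX ⊓ (datum l h5 h6).DeltaC⁆ ⊔
        Subgroup.closure ((fun y : (datum l h5 h6).PiC => y ^ (datum l h5 h6).l) ''
          ((datum l h5 h6).PiX ⊓ (datum l h5 h6).DeltaC : Set (datum l h5 h6).PiC))).topologicalClosure =
      ((⁅PiXm l, PiXm l⁆ ⊔ Subgroup.closure ((fun y : G l => y ^ l) '' (PiXm l : Set (G l))) :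
        Subgroup (G l)) : Subgroup (datum l h5 h6).PiC) := by
  haveI : NeZero l := ⟨by omega⟩
  haveI : DiscreteTopology (datum l h5 h6).PiC := discreteTopology_arithGrp l
  rw [H_eq_of_deltaX_eq (datum l h5 h6) (datum_deltaX h5 h6)]
  exact le_antisymm (Subgroup.topologicalClosure_minimal _ le_rfl (isClosed_discrete _))
    (Subgroup.le_topologicalClosure (G := (datum l h5 h6).PiC) _)

end Datum

/-! ### `H = {1} × H₀` at the lifted model, and the three laws there -/

section Lift

variable (Γ : Type) [Group Γ] [TopologicalSpace Γ] [IsTopologicalGroup Γ] [CompactSpace Γ]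
  [TotallyDisconnectedSpace Γ] (l : ℕ) [NeZero l] (h5 : 5 ≤ l) (h6 : Nat.Coprime l 6)

/-- At `pedOf Γ l`, `Δ_X = {1} × Φ_X`. [claim: Mochizuki2012, status: disputed] -/
theorem pedOf_deltaX : (pedOf Γ l h5 h6).PiX ⊓ (pedOf Γ l h5 h6).DeltaC = botSub Γ l (PiXm l) := by
  rw [pedOf_deltaC]
  show (liftSub Γ l (PiXm l) ⊓ botSub Γ l ⊤ : Subgroup (Γ × G l)) = _
  rw [liftSub_inf_botSub, inf_top_eq]

/-- `{1} × D` is closed in `Γ × Φ` (`= (Γ × D) ∩ Δ_C`). [claim: Mochizuki2012, status: disputed] -/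
theorem isClosed_botSub (D : Subgroup (G l)) :
    letI : TopologicalSpace (G l) := ⊥; IsClosed (botSub Γ l D : Set (Γ × G l)) := by
  letI : TopologicalSpace (G l) := ⊥
  haveI : DiscreteTopology (G l) := ⟨rfl⟩
  have e : botSub Γ l D = liftSub Γ l D ⊓ botSub Γ l ⊤ := by rw [liftSub_inf_botSub, inf_top_eq]
  rw [e, Subgroup.coe_inf, ← geom_extOf]
  exact (isClosed_liftSub Γ l D).inter (extOf Γ l).isClosed_geom

/-- **At `pedOf Γ l`, `H = Ker(Δ_X ↠ Δ_X^{ab} ⊗ ℤ/lℤ) = {1} × H₀`** with `H₀ = ⁅Φ_X, Φ_X⁆ · Φ_X^l` (no closure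
needed: `{1} × H₀` is closed). ([IUTchI] §1 p.37) [claim: Mochizuki2012, status: disputed] -/
theorem pedOf_H_eq :
    (⁅(pedOf Γ l h5 h6).PiX ⊓ (pedOf Γ l h5 h6).DeltaC, (pedOf Γ l h5 h6).PiX ⊓ (pedOf Γ l h5 h6).DeltaC⁆ ⊔
        Subgroup.closure ((fun y : (pedOf Γ l h5 h6).PiC => y ^ (pedOf Γ l h5 h6).l) ''
          ((pedOf Γ l h5 h6).PiX ⊓ (pedOf Γ l h5 h6).DeltaC : Set (pedOf Γ l h5 h6).PiC))).topologicalClosure =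
      (botSub Γ l (⁅PiXm l, PiXm l⁆ ⊔ Subgroup.closure ((fun y : G l => y ^ l) '' (PiXm l : Set (G l)))) :
        Subgroup (pedOf Γ l h5 h6).PiC) := by
  letI : TopologicalSpace (G l) := ⊥
  haveI : DiscreteTopology (G l) := ⟨rfl⟩
  rw [H_eq_of_deltaX_eq (pedOf Γ l h5 h6) (pedOf_deltaX Γ l h5 h6)]
  refine le_antisymm
    (Subgroup.topologicalClosure_minimal _ (le_of_eq (botSub_frattini Γ l (PiXm l))) ?_) ?_
  · exact isClosed_botSub Γ l _
  · rw [← botSub_frattini]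
    exact Subgroup.le_topologicalClosure (G := (pedOf Γ l h5 h6).PiC) _

/-- **NV (hIH) at `pedOf Γ l`: every cusp inertia group `I_x = {1} × ⟨ĉ_x⟩` lies in `H`** (from p449693's
`inertia_le_H_datum`: `ĉ_x` is a commutator in `Φ_X`).  Inhabited ≠ discharged.
([IUTchI] §1 p.37) [claim: Mochizuki2012, status: disputed] -/
theorem pedOf_inertia_le_H (x : (pedOf Γ l h5 h6).Cusp) :
    (pedOf Γ l h5 h6).inertia x ≤
      (⁅(pedOf Γ l h5 h6).PiX ⊓ (pedOf Γ l h5 h6).DeltaC, (pedOf Γ l h5 h6).PiX ⊓ (pedOf Γ l h5 h6).DeltaC⁆ ⊔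
        Subgroup.closure ((fun y : (pedOf Γ l h5 h6).PiC => y ^ (pedOf Γ l h5 h6).l) ''
          ((pedOf Γ l h5 h6).PiX ⊓ (pedOf Γ l h5 h6).DeltaC : Set (pedOf Γ l h5 h6).PiC))).topologicalClosure := by
  rw [pedOf_H_eq, pedOf_inertia]
  refine botSub_mono Γ l ?_
  have h := inertia_le_H_datum h5 h6 x
  rw [datum_H_eq, inertia_eq] at h
  exact h

/-- **NV (hXH) at `pedOf Γ l`: `Δ_X̲ = {1} × N ⊄ H`** (from p449693's `not_deltaXbar_le_H_datum`: `A ∈ N` has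
`A`-coordinate `1 ≠ 0`, while `H₀ ⊆ {A = 0}`).  Inhabited ≠ discharged.
([IUTchI] §1 p.37) [claim: Mochizuki2012, status: disputed] -/
theorem pedOf_not_deltaXbar_le_H :
    ¬ (pedOf Γ l h5 h6).DeltaXbar ≤
      (⁅(pedOf Γ l h5 h6).PiX ⊓ (pedOf Γ l h5 h6).DeltaC, (pedOf Γ l h5 h6).PiX ⊓ (pedOf Γ l h5 h6).DeltaC⁆ ⊔
        Subgroup.closure ((fun y : (pedOf Γ l h5 h6).PiC => y ^ (pedOf Γ l h5 h6).l) ''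
          ((pedOf Γ l h5 h6).PiX ⊓ (pedOf Γ l h5 h6).DeltaC : Set (pedOf Γ l h5 h6).PiC))).topologicalClosure := by
  rw [pedOf_H_eq, pedOf_deltaXbar]
  intro hle
  refine not_deltaXbar_le_H_datum h5 h6 ?_
  rw [datum_H_eq, deltaXbar_eq]
  exact le_of_botSub_le Γ l hle

/-- **NV (hι') at `pedOf Γ l`: the `ι`-law of [IUTchI] Cor. 1.2's resp'd clause** — for `c ∈ Δ_C̲ ∖ Δ_X̲`
(`c = (1, c₂)`, `c₂ ∈ Φ_C̲ ∖ N`) the datum-level witness `v₂ ∈ Φ_X` of p449693's `iotaLaw_datum` for `c₂` lifts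
to `v := (1, v₂) ∈ Δ_X` with `c v c⁻¹ v⁻¹ = (1, c₂ v₂ c₂⁻¹ v₂⁻¹) ∉ H = {1} × H₀`.  Inhabited ≠ discharged.
([IUTchI] §1 p.38) [claim: Mochizuki2012, status: disputed] -/
theorem pedOf_iotaLaw :
    ∀ c ∈ (pedOf Γ l h5 h6).DeltaCbar, c ∉ (pedOf Γ l h5 h6).DeltaXbar →
      ∃ v ∈ (pedOf Γ l h5 h6).PiX ⊓ (pedOf Γ l h5 h6).DeltaC,
        c * v * c⁻¹ * v⁻¹ ∉ (⁅(pedOf Γ l h5 h6).PiX ⊓ (pedOf Γ l h5 h6).DeltaC,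
            (pedOf Γ l h5 h6).PiX ⊓ (pedOf Γ l h5 h6).DeltaC⁆ ⊔
          Subgroup.closure ((fun y : (pedOf Γ l h5 h6).PiC => y ^ (pedOf Γ l h5 h6).l) ''
            ((pedOf Γ l h5 h6).PiX ⊓ (pedOf Γ l h5 h6).DeltaC : Set (pedOf Γ l h5 h6).PiC))).topologicalClosure := by
  intro c hc hcX
  rw [pedOf_H_eq, pedOf_deltaX]
  rw [pedOf_deltaCbar] at hc
  rw [pedOf_deltaXbar] at hcX
  change Γ × G l at c
  obtain ⟨hc1, hc2⟩ := mem_botSub.mp hc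
  have hcX2 : c.2 ∉ Nhat l := fun h => hcX (mem_botSub.mpr ⟨hc1, h⟩)
  -- the datum-level witness `v₂ ∈ Φ_X` for `c₂`
  have hc2' : (c.2 : (datum l h5 h6).PiC) ∈ (datum l h5 h6).DeltaCbar := by rw [deltaCbar_eq]; exact hc2
  have hcX2' : (c.2 : (datum l h5 h6).PiC) ∉ (datum l h5 h6).DeltaXbar := by
    rw [deltaXbar_eq]; exact hcX2
  obtain ⟨v₂, hv₂, hnot⟩ := iotaLaw_datum h5 h6 c.2 hc2' hcX2'
  rw [datum_H_eq] at hnot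
  rw [datum_deltaX] at hv₂
  change G l at v₂
  refine ⟨((1 : Γ), v₂), mem_botSub.mpr ⟨rfl, hv₂⟩, fun hmem => hnot ?_⟩
  exact (lift_comm_mem_botSub_iff Γ l hc1 v₂ _).mp hmem

/-- Packaged at the lifted model: {`ArrowCoveringClaims`, `Rmk121`, `CuspGalois`, `ModLCuspLaws`} (abc-iut-L5-t1,
p431229 / p450225) TOGETHER WITH `hι'`, `hIH`, `hXH` — every input and the output of the `ι`-law chain of
[IUTchI] Cor. 1.2 (`ModLCuspLaws.exists_commutator_not_mem_H`, p448270) — hold at ONE datum over an arbitrary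
profinite `Γ = G_k`.  Inhabited ≠ discharged. ([IUTchI] §1 p.38) [claim: Mochizuki2012, status: disputed] -/
theorem pedOf_iotaLaws :
    (pedOf Γ l h5 h6).ArrowCoveringClaims ∧ (pedOf Γ l h5 h6).Rmk121 ∧ Nonempty (pedOf Γ l h5 h6).CuspGalois ∧
      (pedOf Γ l h5 h6).ModLCuspLaws ∧
      (∀ c ∈ (pedOf Γ l h5 h6).DeltaCbar, c ∉ (pedOf Γ l h5 h6).DeltaXbar →
        ∃ v ∈ (pedOf Γ l h5 h6).PiX ⊓ (pedOf Γ l h5 h6).DeltaC,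
          c * v * c⁻¹ * v⁻¹ ∉ (⁅(pedOf Γ l h5 h6).PiX ⊓ (pedOf Γ l h5 h6).DeltaC,
              (pedOf Γ l h5 h6).PiX ⊓ (pedOf Γ l h5 h6).DeltaC⁆ ⊔
            Subgroup.closure ((fun y : (pedOf Γ l h5 h6).PiC => y ^ (pedOf Γ l h5 h6).l) ''
              ((pedOf Γ l h5 h6).PiX ⊓ (pedOf Γ l h5 h6).DeltaC : Set (pedOf Γ l h5 h6).PiC))).topologicalClosure) ∧
      (∀ x : (pedOf Γ l h5 h6).Cusp, (pedOf Γ l h5 h6).inertia x ≤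
        (⁅(pedOf Γ l h5 h6).PiX ⊓ (pedOf Γ l h5 h6).DeltaC, (pedOf Γ l h5 h6).PiX ⊓ (pedOf Γ l h5 h6).DeltaC⁆ ⊔
          Subgroup.closure ((fun y : (pedOf Γ l h5 h6).PiC => y ^ (pedOf Γ l h5 h6).l) ''
            ((pedOf Γ l h5 h6).PiX ⊓ (pedOf Γ l h5 h6).DeltaC : Set (pedOf Γ l h5 h6).PiC))).topologicalClosure) ∧
      ¬ (pedOf Γ l h5 h6).DeltaXbar ≤
        (⁅(pedOf Γ l h5 h6).PiX ⊓ (pedOf Γ l h5 h6).DeltaC, (pedOf Γ l h5 h6).PiX ⊓ (pedOf Γ l h5 h6).DeltaC⁆ ⊔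
          Subgroup.closure ((fun y : (pedOf Γ l h5 h6).PiC => y ^ (pedOf Γ l h5 h6).l) ''
            ((pedOf Γ l h5 h6).PiX ⊓ (pedOf Γ l h5 h6).DeltaC : Set (pedOf Γ l h5 h6).PiC))).topologicalClosure :=
  ⟨pedOf_arrowCoveringClaims Γ l h5 h6, pedOf_rmk121 Γ l h5 h6, ⟨liftCuspGalois Γ l h5 h6⟩,
    pedOf_modLCuspLaws Γ l h5 h6, pedOf_iotaLaw Γ l h5 h6, pedOf_inertia_le_H Γ l h5 h6,
    pedOf_not_deltaXbar_le_H Γ l h5 h6⟩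

end Lift

/-! ### At the `ThetaGeometry` `geometryOf G_K l` -/

section Theta

variable {GF : Type} [Group GF] [TopologicalSpace GF] [IsTopologicalGroup GF] [CompactSpace GF]
  [TotallyDisconnectedSpace GF] (GK : Subgroup GF) (l : ℕ) [NeZero l]

/-- **At the `ThetaGeometry` `geometryOf G_K l`** (its `K`-level datum is `pe = pedOf G_K l`): `hι'`, `hIH`, `hXH`
hold — so, with abc-iut-L5-t1's `geometryOf_pe_modLCuspLaws` (p450225) and
`exists_thetaGeometry_arrowCoveringClaims` (p431229), every input and the output of the `ι`-law chain of the
Cor. 1.2 closer (p448270) is jointly inhabited WITH the cusp action at a `ThetaGeometry`-level datum.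
Inhabited ≠ discharged. ([IUTchI] Def 3.1 (d) p.62, §1 p.38) [claim: Mochizuki2012, status: disputed] -/
theorem geometryOf_pe_iotaLaws (hGK : IsClosed (GK : Set GF)) (h5 : 5 ≤ l) (h6 : l.Coprime 6) :
    (∀ c ∈ (geometryOf GK l hGK h5 h6).pe.DeltaCbar, c ∉ (geometryOf GK l hGK h5 h6).pe.DeltaXbar →
        ∃ v ∈ (geometryOf GK l hGK h5 h6).pe.PiX ⊓ (geometryOf GK l hGK h5 h6).pe.DeltaC,
          c * v * c⁻¹ * v⁻¹ ∉
            (⁅(geometryOf GK l hGK h5 h6).pe.PiX ⊓ (geometryOf GK l hGK h5 h6).pe.DeltaC,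
                (geometryOf GK l hGK h5 h6).pe.PiX ⊓ (geometryOf GK l hGK h5 h6).pe.DeltaC⁆ ⊔
              Subgroup.closure ((fun y : (geometryOf GK l hGK h5 h6).pe.PiC =>
                  y ^ (geometryOf GK l hGK h5 h6).pe.l) ''
                ((geometryOf GK l hGK h5 h6).pe.PiX ⊓ (geometryOf GK l hGK h5 h6).pe.DeltaC :
                  Set (geometryOf GK l hGK h5 h6).pe.PiC))).topologicalClosure) ∧
      (∀ x : (geometryOf GK l hGK h5 h6).pe.Cusp, (geometryOf GK l hGK h5 h6).pe.inertia x ≤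
        (⁅(geometryOf GK l hGK h5 h6).pe.PiX ⊓ (geometryOf GK l hGK h5 h6).pe.DeltaC,
            (geometryOf GK l hGK h5 h6).pe.PiX ⊓ (geometryOf GK l hGK h5 h6).pe.DeltaC⁆ ⊔
          Subgroup.closure ((fun y : (geometryOf GK l hGK h5 h6).pe.PiC =>
              y ^ (geometryOf GK l hGK h5 h6).pe.l) ''
            ((geometryOf GK l hGK h5 h6).pe.PiX ⊓ (geometryOf GK l hGK h5 h6).pe.DeltaC :
              Set (geometryOf GK l hGK h5 h6).pe.PiC))).topologicalClosure) ∧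
      ¬ (geometryOf GK l hGK h5 h6).pe.DeltaXbar ≤
        (⁅(geometryOf GK l hGK h5 h6).pe.PiX ⊓ (geometryOf GK l hGK h5 h6).pe.DeltaC,
            (geometryOf GK l hGK h5 h6).pe.PiX ⊓ (geometryOf GK l hGK h5 h6).pe.DeltaC⁆ ⊔
          Subgroup.closure ((fun y : (geometryOf GK l hGK h5 h6).pe.PiC =>
              y ^ (geometryOf GK l hGK h5 h6).pe.l) ''
            ((geometryOf GK l hGK h5 h6).pe.PiX ⊓ (geometryOf GK l hGK h5 h6).pe.DeltaC :
              Set (geometryOf GK l hGK h5 h6).pe.PiC))).topologicalClosure := by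
  letI : CompactSpace GK := isCompact_iff_compactSpace.mp hGK.isCompact
  exact ⟨pedOf_iotaLaw GK l h5 h6, pedOf_inertia_le_H GK l h5 h6, pedOf_not_deltaXbar_le_H GK l h5 h6⟩

/-- **∃-form over any compact totally disconnected `G_F ⊇ G_K` (closed)**: ONE `ThetaGeometry G_F G_K l` carries
`ArrowCoveringClaims ∧ Rmk121 ∧ Nonempty CuspGalois ∧ ModLCuspLaws ∧ hι' ∧ hIH ∧ hXH` at its `K`-level datum.
Inhabited ≠ discharged. ([IUTchI] Def 3.1 (d) p.62, §1 p.38) [claim: Mochizuki2012, status: disputed] -/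
theorem exists_thetaGeometry_iotaLaws (hGK : IsClosed (GK : Set GF)) (h5 : 5 ≤ l) (h6 : l.Coprime 6) :
    ∃ geom : ThetaGeometry GF GK l, geom.pe.ArrowCoveringClaims ∧ geom.pe.Rmk121 ∧ Nonempty geom.pe.CuspGalois ∧
      geom.pe.ModLCuspLaws ∧
      (∀ c ∈ geom.pe.DeltaCbar, c ∉ geom.pe.DeltaXbar → ∃ v ∈ geom.pe.PiX ⊓ geom.pe.DeltaC,
        c * v * c⁻¹ * v⁻¹ ∉ (⁅geom.pe.PiX ⊓ geom.pe.DeltaC, geom.pe.PiX ⊓ geom.pe.DeltaC⁆ ⊔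
          Subgroup.closure ((fun y : geom.pe.PiC => y ^ geom.pe.l) ''
            (geom.pe.PiX ⊓ geom.pe.DeltaC : Set geom.pe.PiC))).topologicalClosure) ∧
      (∀ x : geom.pe.Cusp, geom.pe.inertia x ≤ (⁅geom.pe.PiX ⊓ geom.pe.DeltaC, geom.pe.PiX ⊓ geom.pe.DeltaC⁆ ⊔
          Subgroup.closure ((fun y : geom.pe.PiC => y ^ geom.pe.l) ''
            (geom.pe.PiX ⊓ geom.pe.DeltaC : Set geom.pe.PiC))).topologicalClosure) ∧
      ¬ geom.pe.DeltaXbar ≤ (⁅geom.pe.PiX ⊓ geom.pe.DeltaC, geom.pe.PiX ⊓ geom.pe.DeltaC⁆ ⊔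
          Subgroup.closure ((fun y : geom.pe.PiC => y ^ geom.pe.l) ''
            (geom.pe.PiX ⊓ geom.pe.DeltaC : Set geom.pe.PiC))).topologicalClosure := by
  letI : CompactSpace GK := isCompact_iff_compactSpace.mp hGK.isCompact
  exact ⟨geometryOf GK l hGK h5 h6, pedOf_iotaLaws GK l h5 h6⟩

end Theta

/-- **Over a Galois tower `F ⊆ K ⊆ F̄`**: a `ThetaGeometry (F̄ ≃ₐ[F] F̄) (galoisSubgroupOf F K F̄) l` carrying
`ArrowCoveringClaims ∧ Rmk121 ∧ Nonempty CuspGalois ∧ ModLCuspLaws ∧ hι' ∧ hIH ∧ hXH` at its `K`-level datum — the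
`ι`-law chain of [IUTchI] Cor. 1.2 fires, with the cusp action, at a `ThetaGeometry` over genuine absolute
Galois groups [model; finite geometric part].  Inhabited ≠ discharged.
([IUTchI] Def 3.1 (d) p.62, §1 p.38) [claim: Mochizuki2012, status: disputed] -/
theorem exists_thetaGeometry_galois_iotaLaws {F Fbar : Type} [Field F] [Field Fbar] [Algebra F Fbar]
    (K : Type) [Field K] [Algebra F K] [Algebra K Fbar] [IsScalarTower F K Fbar] [IsGalois F Fbar] {l : ℕ}
    (h5 : 5 ≤ l) (h6 : l.Coprime 6) :
    ∃ geom : ThetaGeometry (Fbar ≃ₐ[F] Fbar) (galoisSubgroupOf F K Fbar) l,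
      geom.pe.ArrowCoveringClaims ∧ geom.pe.Rmk121 ∧ Nonempty geom.pe.CuspGalois ∧ geom.pe.ModLCuspLaws ∧
      (∀ c ∈ geom.pe.DeltaCbar, c ∉ geom.pe.DeltaXbar → ∃ v ∈ geom.pe.PiX ⊓ geom.pe.DeltaC,
        c * v * c⁻¹ * v⁻¹ ∉ (⁅geom.pe.PiX ⊓ geom.pe.DeltaC, geom.pe.PiX ⊓ geom.pe.DeltaC⁆ ⊔
          Subgroup.closure ((fun y : geom.pe.PiC => y ^ geom.pe.l) ''
            (geom.pe.PiX ⊓ geom.pe.DeltaC : Set geom.pe.PiC))).topologicalClosure) ∧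
      (∀ x : geom.pe.Cusp, geom.pe.inertia x ≤ (⁅geom.pe.PiX ⊓ geom.pe.DeltaC, geom.pe.PiX ⊓ geom.pe.DeltaC⁆ ⊔
          Subgroup.closure ((fun y : geom.pe.PiC => y ^ geom.pe.l) ''
            (geom.pe.PiX ⊓ geom.pe.DeltaC : Set geom.pe.PiC))).topologicalClosure) ∧
      ¬ geom.pe.DeltaXbar ≤ (⁅geom.pe.PiX ⊓ geom.pe.DeltaC, geom.pe.PiX ⊓ geom.pe.DeltaC⁆ ⊔
          Subgroup.closure ((fun y : geom.pe.PiC => y ^ geom.pe.l) ''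
            (geom.pe.PiX ⊓ geom.pe.DeltaC : Set geom.pe.PiC))).topologicalClosure :=
  haveI : NeZero l := ⟨by omega⟩
  exists_thetaGeometry_iotaLaws _ l (ThetaGeometryModel.isClosed_galoisSubgroupOf F K Fbar) h5 h6

end ArrowModel

end PuncturedEllipticData

end Literature.IUT.HodgeTheaters
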